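import Summits.QuantumFields.YangMills.Theorems.BalabanUVNodesN15KingModelHeatKernelGreenPowerLawFour
import Summits.QuantumFields.YangMills.Theorems.BalabanUVNodesN15KingModelFreeKernelThermodynamicLimit
import HarnessLib

/-!
# BalabanUVNodes ∕ N15 — THE KING-MODEL RUNG (PART Ϣ-k): THE MASS-UNIFORM POWER LAW OF THE FREE RESOLVENT KERNEL ON `ℤ⁴` —
# `c·|K_∞(z)| ≤ 34016∕(1 + z_ν²)` for every coordinate `ν`, every `c > 0`, `m² > 0` (the thermodynamic limit of PART Ϣ-h: the zero mode `8c∕(m²K₀⁴)` disappears and NOTHING depends on the mass)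
# (Track A, DAG node N15 = NE2; FAN-OUT v1.1 §N15 s3 «KING-MODEL RUNG … + what the curved case adds»; count-neutral)

HONEST FRAMING.  Count-neutral (cell `pub-ymgap`, seat `pub-ymgap-dag-n15-e` g55; `--supports stmt-QuantumFields-27247 --as helper` = K3ᴬ).  Ε-a's free massive resolvent kernel on the
INFINITE lattice, `K_∞(z) = freeKer c m² z = (2π)⁻⁴∫e^{ip·z}dp∕(m² + cΣ_μ(2−2cos p_μ))` ([Ba4] (2.43)∕King (4.4); King's covariance on `ℤ⁴` in the thermodynamic limit), is the `N → ∞`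
limit of the cube-torus covariances `(lapF (ℤ∕(N+1))⁴)⁻¹(z mod (N+1), 0)` (Ε-f `tendsto_lapF_inv_cube`).  PART Ϣ-h bounds each of these by `34016∕(1+|v(z_ν mod (N+1))|²) + 8c∕(m²(N+1)⁴)`
(the cube torus `fun _ => N+1` IS the tree's `cM (N+1)`); for `2|z_ν| < N+1` the centred representative is `z_ν` itself, and the zero mode tends to `0`: ★★★★ **`mul_abs_freeKer_le_powerLaw`** —
`c·|K_∞(z)| ≤ 34016∕(1 + z_ν²)` for EVERY `ν`, uniformly in `c∕m²` with NO remainder: equivalently (`c·K_∞(z; m², c) = K_∞(z; m²∕c, 1)`, Ε-h monotone in the mass) the bound of the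
MASSLESS four-dimensional lattice Green's function by `34016∕(1+|z|_∞²)` — the discrete `1∕(4π²|z|²)` law up to the crude constant ([LawlerLimic2010] Thm 4.3.1 gives the asymptotics; the tree's
`Hara2008_thm13_holds` the asymptotic Gaussian lemma for general kernels; this is an explicit, non-asymptotic, first-principles upper bound; the «equivalently» clause is a reading, no
rescaling lemma is stated here).  §2 (v1.1) ★★★ **`mul_abs_freeKer_le_powerLaw_supNorm`** ∕ `mul_freeKer_le_powerLaw_supNorm` — the best coordinate: `c·|K_∞(z)| ≤ 34016∕(1 + max_ν z_ν²)`,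
i.e. the `|z|_∞⁻²` law (one line from the `∀ ν` form by `Finset.exists_mem_eq_sup'`).  NOT a node discharge; nothing continuum ∕ Clay.
v1.1 (g56): §2 added — the corollary the v1.0 header advertised without stating it (referee ref-F READ-1141 NIT-1); §1 declarations byte-identical.
PRIOR TREE ART (by name): PART Ϣ-h `mul_abs_lapF_inv_le_powerLaw`; Ε-f `…FreeKernelThermodynamicLimit` (`cubePt`, `tendsto_lapF_inv_cube`); Ε-a `freeKer`; `Beta.WoodburyFibre.cM`; Mathlib
`ZMod.valMinAbs_spec`, `le_of_tendsto_of_tendsto`.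
Dedup (rg at filing): basename 0 files; needles `mul_abs_freeKer_le_powerLaw|valMinAbs_cubePt_eq|tendsto_zeroMode_cube` 0 tree files (v1.1: `freeKer_le_powerLaw_supNorm` 0 other files).
Locators: [King1986] (4.4) p.670, (2.13) p.653; [Balaban1983RegularityDecay] (2.43) p.584; [Balaban1984PropagatorsI] p.36 l.20–23; [LawlerLimic2010] Thm 4.3.1.  0 `sorry`, 0 `def`.
-/

noncomputable section

open Real Set Finset Filter
open scoped BigOperators Topology

namespace Summit.QuantumFields.YangMills.BalabanUVNodes.N15KingModelRung.HeatKernel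

open Literature.MathematicalPhysics.QuantumFieldTheory.Balaban1983to89.B5Prop11Plancherel (Tor)
open Literature.MathematicalPhysics.QuantumFieldTheory.Balaban1983to89.Beta.WoodburyFibre (cM)
open Literature.MathematicalPhysics.QuantumFieldTheory.King1986.Torus (lapF)
open Summit.QuantumFields.YangMills.BalabanUVNodes.N15KingModelRung.TorusSpectral (freeKer cubePt tendsto_lapF_inv_cube)

variable {c m2 : ℝ}

/-- For `2|z_ν| < N+1` the centred representative of `z_ν mod (N+1)` is `z_ν`. [folklore] -/
theorem valMinAbs_cubePt_eq {N : ℕ} (z : Fin 4 → ℤ) (ν : Fin 4) (hz : 2 * |z ν| < (N : ℤ) + 1) :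
    ((cubePt N z - 0) ν).valMinAbs = z ν := by
  rw [sub_zero]
  unfold cubePt
  rw [ZMod.valMinAbs_spec]
  refine ⟨rfl, ?_⟩
  constructor
  · push_cast
    have := neg_abs_le (z ν)
    linarith
  · push_cast
    have := le_abs_self (z ν)
    linarith

/-- PART Ϣ-h on the cube torus `(ℤ∕(N+1))⁴` at the site `z mod (N+1)`, for `2|z_ν| < N+1`: `c·|G_N(z,0)| ≤ 34016∕(1 + z_ν²) + 8c∕(m²(N+1)⁴)`. [cite: King1986, (4.4) p.670, (2.13) p.653] -/
theorem mul_abs_lapF_inv_cube_le (hc : 0 < c) (hm : 0 < m2) (z : Fin 4 → ℤ) (ν : Fin 4) {N : ℕ} (hz : 2 * |z ν| < (N : ℤ) + 1) :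
    c * |(lapF (fun _ : Fin 4 => N + 1) c m2)⁻¹ (cubePt N z) 0| ≤ 34016 / (1 + ((z ν : ℤ) : ℝ) ^ 2) + 8 * c / (m2 * ((N + 1 : ℕ) : ℝ) ^ 4) := by
  have h := mul_abs_lapF_inv_le_powerLaw (K₀ := N + 1) hc hm (cubePt N z) 0 ν
  have hv : ((((cubePt N z - 0) ν).valMinAbs.natAbs : ℕ) : ℝ) ^ 2 = ((z ν : ℤ) : ℝ) ^ 2 := by
    rw [Nat.cast_natAbs, Int.cast_abs, sq_abs, valMinAbs_cubePt_eq z ν hz]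
  rw [hv] at h
  exact h

/-- The zero mode of the cube torus vanishes in the thermodynamic limit: `8c∕(m²(N+1)⁴) → 0`. [folklore] -/
theorem tendsto_zeroMode_cube (c m2 : ℝ) : Tendsto (fun N : ℕ => 8 * c / (m2 * ((N + 1 : ℕ) : ℝ) ^ 4)) atTop (𝓝 0) := by
  have h1 : Tendsto (fun N : ℕ => ((N + 1 : ℕ) : ℝ)) atTop atTop := by
    exact tendsto_natCast_atTop_atTop.comp (tendsto_add_atTop_nat 1)
  have h2 : Tendsto (fun N : ℕ => ((N + 1 : ℕ) : ℝ) ^ 4) atTop atTop := tendsto_pow_atTop (by norm_num) |>.comp h1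
  have h3 : Tendsto (fun N : ℕ => (((N + 1 : ℕ) : ℝ) ^ 4)⁻¹) atTop (𝓝 0) := tendsto_inv_atTop_zero.comp h2
  have e : (fun N : ℕ => 8 * c / (m2 * ((N + 1 : ℕ) : ℝ) ^ 4)) = fun N : ℕ => (8 * c / m2) * (((N + 1 : ℕ) : ℝ) ^ 4)⁻¹ := by
    funext N; rw [div_mul_eq_div_div, div_eq_mul_inv]
  rw [e]
  simpa using h3.const_mul (8 * c / m2)

/-- ★★★★ **THE MASS-UNIFORM POWER LAW OF THE FREE RESOLVENT KERNEL ON `ℤ⁴`**: for every `c > 0`, `m² > 0`, `z ∈ ℤ⁴` and every coordinate `ν`,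
`c·|K_∞(z)| ≤ 34016∕(1 + z_ν²)` — the thermodynamic limit of PART Ϣ-h (Ε-f `tendsto_lapF_inv_cube`), where the zero mode disappears and no trace of the mass remains: the explicit,
non-asymptotic form of the four-dimensional `|z|⁻²` law, uniform over ALL masses (equivalently a bound on the massless lattice Green's function by Ε-h's monotonicity).
[cite: King1986, (4.4) p.670, (2.13) p.653; Balaban1983RegularityDecay, (2.43) p.584; LawlerLimic2010, Thm 4.3.1] -/
theorem mul_abs_freeKer_le_powerLaw (hc : 0 < c) (hm : 0 < m2) (z : Fin 4 → ℤ) (ν : Fin 4) :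
    c * |freeKer c m2 z| ≤ 34016 / (1 + ((z ν : ℤ) : ℝ) ^ 2) := by
  have hlim := tendsto_lapF_inv_cube (d := 3) hc.le hm z
  have hf : Tendsto (fun N : ℕ => c * |(lapF (fun _ : Fin 4 => N + 1) c m2)⁻¹ (cubePt N z) 0|) atTop (𝓝 (c * |freeKer c m2 z|)) :=
    (hlim.abs).const_mul c
  have hg : Tendsto (fun N : ℕ => 34016 / (1 + ((z ν : ℤ) : ℝ) ^ 2) + 8 * c / (m2 * ((N + 1 : ℕ) : ℝ) ^ 4)) atTop
      (𝓝 (34016 / (1 + ((z ν : ℤ) : ℝ) ^ 2))) := by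
    have := (tendsto_zeroMode_cube c m2).const_add (34016 / (1 + ((z ν : ℤ) : ℝ) ^ 2))
    simpa using this
  refine le_of_tendsto_of_tendsto hf hg ?_
  refine Filter.eventually_atTop.2 ⟨(2 * |z ν|).toNat, fun N hN => ?_⟩
  have hz : 2 * |z ν| < (N : ℤ) + 1 := by
    have : (2 * |z ν|) ≤ ((2 * |z ν|).toNat : ℤ) := Int.self_le_toNat _
    have hN' : ((2 * |z ν|).toNat : ℤ) ≤ N := by exact_mod_cast hN
    linarith
  exact mul_abs_lapF_inv_cube_le hc hm z ν hz

/-- ★★★ … hence `K_∞ ≥ 0` (Ε-h) gives `c·K_∞(z) ≤ 34016∕(1 + z_ν²)` without the absolute value, for every `ν`. [cite: King1986, (4.4) p.670; Balaban1983RegularityDecay, (2.43) p.584] -/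
theorem mul_freeKer_le_powerLaw (hc : 0 < c) (hm : 0 < m2) (z : Fin 4 → ℤ) (ν : Fin 4) :
    c * freeKer c m2 z ≤ 34016 / (1 + ((z ν : ℤ) : ℝ) ^ 2) :=
  (mul_le_mul_of_nonneg_left (le_abs_self _) hc.le).trans (mul_abs_freeKer_le_powerLaw hc hm z ν)

/-! ## §2 (v1.1) The best coordinate: the `|z|_∞⁻²` law -/

/-- ★★★ **THE SUP-NORM FORM**: `c·|K_∞(z)| ≤ 34016∕(1 + max_ν z_ν²)` for every `c > 0`, `m² > 0`, `z ∈ ℤ⁴` — §1 at the coordinate where `z_ν²` is largest (`max_ν z_ν² = |z|_∞²`).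
[cite: King1986, (4.4) p.670, (2.13) p.653; Balaban1983RegularityDecay, (2.43) p.584; LawlerLimic2010, Thm 4.3.1] -/
theorem mul_abs_freeKer_le_powerLaw_supNorm (hc : 0 < c) (hm : 0 < m2) (z : Fin 4 → ℤ) :
    c * |freeKer c m2 z| ≤ 34016 / (1 + Finset.univ.sup' Finset.univ_nonempty (fun ν : Fin 4 => ((z ν : ℤ) : ℝ) ^ 2)) := by
  obtain ⟨ν, -, hν⟩ := Finset.exists_mem_eq_sup' (Finset.univ_nonempty (α := Fin 4)) (fun ν : Fin 4 => ((z ν : ℤ) : ℝ) ^ 2)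
  rw [hν]
  exact mul_abs_freeKer_le_powerLaw hc hm z ν

/-- ★★★ … and without the absolute value (`K_∞ ≥ 0`): `c·K_∞(z) ≤ 34016∕(1 + max_ν z_ν²)`. [cite: King1986, (4.4) p.670; Balaban1983RegularityDecay, (2.43) p.584] -/
theorem mul_freeKer_le_powerLaw_supNorm (hc : 0 < c) (hm : 0 < m2) (z : Fin 4 → ℤ) :
    c * freeKer c m2 z ≤ 34016 / (1 + Finset.univ.sup' Finset.univ_nonempty (fun ν : Fin 4 => ((z ν : ℤ) : ℝ) ^ 2)) :=
  (mul_le_mul_of_nonneg_left (le_abs_self _) hc.le).trans (mul_abs_freeKer_le_powerLaw_supNorm hc hm z)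

end Summit.QuantumFields.YangMills.BalabanUVNodes.N15KingModelRung.HeatKernel

end
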